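import Summits.Ventures.PercRepro.S2LPCoresP12D6to10
import Summits.Ventures.PercRepro.S2LPCoresP12D11to15
import Summits.Ventures.PercRepro.S2LPCoresP12D16to20
import Summits.Ventures.PercRepro.S2LPCoresP12D21to25
import Summits.Ventures.PercRepro.S2LPCoresP12D26to30
import Summits.Ventures.PercRepro.S2LPCoresP12D31to35
import Summits.Ventures.PercRepro.S2LPCoresP12D36to38
import Summits.Ventures.PercRepro.S2TwelveKeyCellsA
import Summits.Ventures.PercRepro.S2TwelveKeyCellsB
import Summits.Ventures.PercRepro.S2CoreTwelve
import Summits.Ventures.PercRepro.RankLevelSetLevelFiveCqFourteen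
import Summits.Ventures.PercRepro.S2RowStep

/-!
# PercRepro — THEOREM C₅ AT EVERY `p ≥ 13` (p7, gen 20; sub-claim S2): THE `p = 12` ROW, THE RUNG `13` OF THE LEVEL-5 LADDER

The `p = 12` row of the `e`-free core at every corank `d ≥ 6`: `6 ≤ d ≤ 38` by the LP-certificate cells in SUBCLAIM-S2's form (`S2LP.c025_core_five_twelve_<d>`, p2's exact certificates / the consumer pipeline), `39 ≤ d ≤ 62` by the plain key cells (`c025_twelve_key_<d>`), `d ≥ 63` by the big core `c025_core_five_at_twelve_big`:
**`c025_core_five_twelve_all (M) [M.Finite] (hR : ρ(E) = 12) (hbig : 12 + 5 < |E|) (hfree) : RLS M 12 5`**. With the row step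
(`c025_five_large_of_rows 13`, the rows `12` and `13`, Theorem C₅ at `14`): **`c025_five_large_sharp13 (M) [M.Finite] (p) (hp : 13 ≤ p) :
RLS M p 5`**. No window move is claimed here (the lead's). Axioms: standard.
-/

open scoped Matroid

namespace PercRepro

namespace ThmN

variable {α : Type}

/-- The LP-certificate cells of the `p = 12` row, `6 ≤ d ≤ 21` (p2's form `S2LP.c025_core_five_twelve_<d>`), dispatched by `d`. -/
theorem c025_core_five_twelve_lpa (M : Matroid α) [M.Finite] (d : ℕ) (hda : 6 ≤ d) (hdb : d ≤ 21)
    (hR : M.eRank = ((12 : ℕ) : ℕ∞)) (hn : M.E.ncard = 12 + d)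
    (hfree : ∀ e ∈ M.E, ∃ A ⊆ M.E \ {e}, e ∉ M.closure A ∧ e ∉ M.closure ((M.E \ {e}) \ A)) : RLS M 12 5 := by
  interval_cases d
  · exact S2LP.c025_core_five_twelve_six M hR hn hfree
  · exact S2LP.c025_core_five_twelve_seven M hR hn hfree
  · exact S2LP.c025_core_five_twelve_eight M hR hn hfree
  · exact S2LP.c025_core_five_twelve_nine M hR hn hfree
  · exact S2LP.c025_core_five_twelve_ten M hR hn hfree
  · exact S2LP.c025_core_five_twelve_eleven M hR hn hfree
  · exact S2LP.c025_core_five_twelve_twelve M hR hn hfree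
  · exact S2LP.c025_core_five_twelve_thirteen M hR hn hfree
  · exact S2LP.c025_core_five_twelve_fourteen M hR hn hfree
  · exact S2LP.c025_core_five_twelve_fifteen M hR hn hfree
  · exact S2LP.c025_core_five_twelve_sixteen M hR hn hfree
  · exact S2LP.c025_core_five_twelve_seventeen M hR hn hfree
  · exact S2LP.c025_core_five_twelve_eighteen M hR hn hfree
  · exact S2LP.c025_core_five_twelve_nineteen M hR hn hfree
  · exact S2LP.c025_core_five_twelve_twenty M hR hn hfree
  · exact S2LP.c025_core_five_twelve_twentyone M hR hn hfree

/-- The LP-certificate cells of the `p = 12` row, `22 ≤ d ≤ 37` (p2's form `S2LP.c025_core_five_twelve_<d>`), dispatched by `d`. -/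
theorem c025_core_five_twelve_lpb (M : Matroid α) [M.Finite] (d : ℕ) (hda : 22 ≤ d) (hdb : d ≤ 37)
    (hR : M.eRank = ((12 : ℕ) : ℕ∞)) (hn : M.E.ncard = 12 + d)
    (hfree : ∀ e ∈ M.E, ∃ A ⊆ M.E \ {e}, e ∉ M.closure A ∧ e ∉ M.closure ((M.E \ {e}) \ A)) : RLS M 12 5 := by
  interval_cases d
  · exact S2LP.c025_core_five_twelve_twentytwo M hR hn hfree
  · exact S2LP.c025_core_five_twelve_twentythree M hR hn hfree
  · exact S2LP.c025_core_five_twelve_twentyfour M hR hn hfree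
  · exact S2LP.c025_core_five_twelve_twentyfive M hR hn hfree
  · exact S2LP.c025_core_five_twelve_twentysix M hR hn hfree
  · exact S2LP.c025_core_five_twelve_twentyseven M hR hn hfree
  · exact S2LP.c025_core_five_twelve_twentyeight M hR hn hfree
  · exact S2LP.c025_core_five_twelve_twentynine M hR hn hfree
  · exact S2LP.c025_core_five_twelve_thirty M hR hn hfree
  · exact S2LP.c025_core_five_twelve_thirtyone M hR hn hfree
  · exact S2LP.c025_core_five_twelve_thirtytwo M hR hn hfree
  · exact S2LP.c025_core_five_twelve_thirtythree M hR hn hfree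
  · exact S2LP.c025_core_five_twelve_thirtyfour M hR hn hfree
  · exact S2LP.c025_core_five_twelve_thirtyfive M hR hn hfree
  · exact S2LP.c025_core_five_twelve_thirtysix M hR hn hfree
  · exact S2LP.c025_core_five_twelve_thirtyseven M hR hn hfree

/-- The LP-certificate cells of the `p = 12` row, `38 ≤ d ≤ 38` (p2's form `S2LP.c025_core_five_twelve_<d>`), dispatched by `d`. -/
theorem c025_core_five_twelve_lpc (M : Matroid α) [M.Finite] (d : ℕ) (hda : 38 ≤ d) (hdb : d ≤ 38)
    (hR : M.eRank = ((12 : ℕ) : ℕ∞)) (hn : M.E.ncard = 12 + d)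
    (hfree : ∀ e ∈ M.E, ∃ A ⊆ M.E \ {e}, e ∉ M.closure A ∧ e ∉ M.closure ((M.E \ {e}) \ A)) : RLS M 12 5 := by
  interval_cases d
  · exact S2LP.c025_core_five_twelve_thirtyeight M hR hn hfree

/-- The plain key cells of the `p = 12` row, `39 ≤ d ≤ 54` (`c025_twelve_key_<d>`), dispatched by `d`. -/
theorem c025_core_five_twelve_keya (M : Matroid α) [M.Finite] (d : ℕ) (hda : 39 ≤ d) (hdb : d ≤ 54)
    (hR : M.eRank = ((12 : ℕ) : ℕ∞)) (hn : M.E.ncard = 12 + d)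
    (hfree : ∀ e ∈ M.E, ∃ A ⊆ M.E \ {e}, e ∉ M.closure A ∧ e ∉ M.closure ((M.E \ {e}) \ A)) : RLS M 12 5 := by
  interval_cases d
  · exact c025_twelve_key_39 M hR hn hfree
  · exact c025_twelve_key_40 M hR hn hfree
  · exact c025_twelve_key_41 M hR hn hfree
  · exact c025_twelve_key_42 M hR hn hfree
  · exact c025_twelve_key_43 M hR hn hfree
  · exact c025_twelve_key_44 M hR hn hfree
  · exact c025_twelve_key_45 M hR hn hfree
  · exact c025_twelve_key_46 M hR hn hfree
  · exact c025_twelve_key_47 M hR hn hfree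
  · exact c025_twelve_key_48 M hR hn hfree
  · exact c025_twelve_key_49 M hR hn hfree
  · exact c025_twelve_key_50 M hR hn hfree
  · exact c025_twelve_key_51 M hR hn hfree
  · exact c025_twelve_key_52 M hR hn hfree
  · exact c025_twelve_key_53 M hR hn hfree
  · exact c025_twelve_key_54 M hR hn hfree

/-- The plain key cells of the `p = 12` row, `55 ≤ d ≤ 62` (`c025_twelve_key_<d>`), dispatched by `d`. -/
theorem c025_core_five_twelve_keyb (M : Matroid α) [M.Finite] (d : ℕ) (hda : 55 ≤ d) (hdb : d ≤ 62)
    (hR : M.eRank = ((12 : ℕ) : ℕ∞)) (hn : M.E.ncard = 12 + d)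
    (hfree : ∀ e ∈ M.E, ∃ A ⊆ M.E \ {e}, e ∉ M.closure A ∧ e ∉ M.closure ((M.E \ {e}) \ A)) : RLS M 12 5 := by
  interval_cases d
  · exact c025_twelve_key_55 M hR hn hfree
  · exact c025_twelve_key_56 M hR hn hfree
  · exact c025_twelve_key_57 M hR hn hfree
  · exact c025_twelve_key_58 M hR hn hfree
  · exact c025_twelve_key_59 M hR hn hfree
  · exact c025_twelve_key_60 M hR hn hfree
  · exact c025_twelve_key_61 M hR hn hfree
  · exact c025_twelve_key_62 M hR hn hfree

/-- **THE WHOLE `p = 12` ROW FOR CORES**: every `e`-free core of rank `12` on `> 17` points satisfies `RLS M 12 5`. -/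
theorem c025_core_five_twelve_all (M : Matroid α) [M.Finite]
    (hR : M.eRank = ((12 : ℕ) : ℕ∞)) (hbig : 12 + 5 < M.E.ncard)
    (hfree : ∀ e ∈ M.E, ∃ A ⊆ M.E \ {e}, e ∉ M.closure A ∧ e ∉ M.closure ((M.E \ {e}) \ A)) : RLS M 12 5 := by
  have hn : M.E.ncard = 12 + (M.E.ncard - 12) := by omega
  rcases Nat.lt_or_ge M.E.ncard (12 + 22) with h21 | h21
  · exact c025_core_five_twelve_lpa M (M.E.ncard - 12) (by omega) (by omega) hR hn hfree
  rcases Nat.lt_or_ge M.E.ncard (12 + 38) with h37 | h37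
  · exact c025_core_five_twelve_lpb M (M.E.ncard - 12) (by omega) (by omega) hR hn hfree
  rcases Nat.lt_or_ge M.E.ncard (12 + 39) with h38 | h38
  · exact c025_core_five_twelve_lpc M (M.E.ncard - 12) (by omega) (by omega) hR hn hfree
  rcases Nat.lt_or_ge M.E.ncard (12 + 55) with h54 | h54
  · exact c025_core_five_twelve_keya M (M.E.ncard - 12) (by omega) (by omega) hR hn hfree
  rcases Nat.lt_or_ge M.E.ncard (12 + 63) with h62 | h62
  · exact c025_core_five_twelve_keyb M (M.E.ncard - 12) (by omega) (by omega) hR hn hfree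
  exact c025_core_five_at_twelve_big M (by omega) hfree

/-- **THEOREM C₅ AT EVERY `p ≥ 13`**: `RLS M p 5` for every finite matroid and every `p ≥ 13` (the row step on the rows `12` and `13`). -/
theorem c025_five_large_sharp13 (M : Matroid α) [M.Finite] (p : ℕ) (hp : 13 ≤ p) : RLS M p 5 :=
  c025_five_large_of_rows 13 (by norm_num)
    (fun M _ hR hbig hfree => c025_core_five_twelve_all M hR hbig hfree)
    (fun M _ hR hbig hfree => c025_core_five_thirteen_all M hR hbig hfree)
    (fun M _ p hp => c025_five_large_sharp14 M p hp) M p hp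

end ThmN

end PercRepro
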